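import Literature.Probability.Percolation.CornerPercolation
import Literature.Probability.Percolation.RSWProofs
import Summits.CriticalPhenomena.CardyFormulaZ2.Theorems.CardySelfDualSegmentUniformBoxCrossingStubGlue
import HarnessLib

/-!
# Stub `stub_join` (crux stmt-CriticalPhenomena-5476 `UniformBoxCrossing`, line `Sketch`):
# joined crossings of two stacked squares ⇒ hard-way crossings of `2:1` rectangles, uniformly in `t`

Bollobás–Riordan, *Percolation on self-dual polygon configurations* (2010, arXiv:1001.4674),
§5.1, Lemmas 5.4–5.5, for the corner percolation models `M_t = cornerPercolation t` on `ℤ²`,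
`t ∈ [0, 1]`.

Write `S₁ = [0, n]²`, `S₂ = S₁ + (0, k)`, so `S₁ ∪ S₂ = [0, n] × [0, n + k]`. The JOIN event
`J(n, k)` (the hypothesis of the stub, produced by the B–R chaining engine) asks for open
horizontal crossings `P₁` of `S₁` and `P₂` of `S₂` joined by an open path inside `S₁ ∪ S₂`.

* `tbCrossing_of_join` — **crossings of a square meet** (B–R Lemma 5.5, deterministic part): on
  `J(n, k) ∩ TB(S₁) ∩ TB(S₂)` the rectangle `[0, n] × [0, n + k]` has an open vertical crossing:
  the vertical crossing `Q₁` of `S₁` meets `P₁` (`exists_mem_support_of_crossing`, the discrete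
  Jordan curve lemma of `PlanarDuality.lean`), `Q₂` meets `P₂`, and
  `bottom(S₁) ↔ P₁ ↔ P₂ ↔ top(S₂)` inside `S₁ ∪ S₂`.
* `quarter_le_real_lrCrossing_of_join` — the probabilistic part: `J`, `TB(S₁)`, `TB(S₂)` are
  increasing and measurable, squares are crossed with `M_t`-probability `≥ 1/2`
  (`cornerPercolation_half_le_real_tbCrossing_self`, translation invariance
  `cornerPercolation_real_openCrossing_shift`), so Harris–FKG for `M_t`
  (`cornerPercolation_real_inter_ge`, twice) gives `M_t(J)/4 ≤ M_t(TB([0, n] × [0, n + k]))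
  = M_t(LR([0, n + k] × [0, n]))` (transposition, `cornerPercolation_real_tbCrossing`).
* `stub_join` — the registered stub (B–R Lemma 5.4, in the tree's horizontal normalisation):
  `M_t(LR([0, n + j k] × [0, n])) ≥ (1/2) (c/8)^j` by induction on `j` (the sibling's gluing
  inequality `cornerPercolation_real_glue` with `m₁ = n + j k`, `m₂ = n + k` through an
  exact-`1/2` square of side `n`), and `n + K k ≥ 2 n` because `n ≤ K k`, so antitonicity in the
  width (`cornerPercolation_real_lrCrossing_anti_left`) gives `M_t(LR([0, 2n] × [0, n])) ≥
  (1/2) (c/8)^K`, uniformly in `t ∈ [0, 1]` and `n ≥ n₀` (the shift `k` depends on `(t, n)` only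
  through `n ≤ K k`).
-/

noncomputable section

namespace Summit.CriticalPhenomena.CardyFormulaZ2.Cruxes.UniformBoxCrossing.NonSlantLine

open MeasureTheory Literature.Probability.Percolation Literature.Probability.LatticeModels

/-- Measurability of a bounded existential over a finite set of a countable type: if every
`{a | p b a}` is measurable then so is `{a | ∃ b ∈ s, p b a} = ⋃_{b ∈ s} {a | p b a}`.
[folklore] -/
theorem measurableSet_setOf_exists_mem {α β : Type*} [MeasurableSpace α] [Countable β]
    {s : Finset β} {p : β → α → Prop} (hp : ∀ b, MeasurableSet {a | p b a}) :
    MeasurableSet {a | ∃ b ∈ s, p b a} := by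
  have h : {a | ∃ b ∈ s, p b a} = ⋃ b, {_a | b ∈ s} ∩ {a | p b a} := by
    ext a
    simp
  rw [h]
  exact MeasurableSet.iUnion fun b => (MeasurableSet.const _).inter (hp b)

/-- **Crossings of a square meet** (Bollobás–Riordan 2010, Lemma 5.5, deterministic content).
Let `S₁ = [0, n]²`, `S₂ = S₁ + (0, k)`. For a lattice configuration `ω`: if `a₁ ↔ b₁` is an open
horizontal crossing of `S₁`, `a₂ + (0, k) ↔ b₂ + (0, k)` an open horizontal crossing of `S₂`,
`a₁ ↔ a₂ + (0, k)` inside `S₁ ∪ S₂ = [0, n] × [0, n + k]`, and `S₁`, `S₂` both have open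
vertical crossings, then `[0, n] × [0, n + k]` has an open vertical crossing: the vertical
crossing of `S₁` meets the horizontal one at some `w₁`, that of `S₂` meets its horizontal one at
some `w₂` (`exists_mem_support_of_crossing`), and
`bottom(S₁) ↔ w₁ ↔ a₁ ↔ a₂ + (0, k) ↔ w₂ ↔ top(S₂)` inside `S₁ ∪ S₂`.
[cite: BollobasRiordan2010, §5.1 Lemma 5.5] -/
theorem tbCrossing_of_join {n k : ℕ} {ω : BondConfig (Site 2)} (hω : ω ⊆ (zdGraph 2).edgeSet)
    {a₁ b₁ a₂ b₂ : Site 2} (ha₁ : a₁ ∈ leftSide n n) (hb₁ : b₁ ∈ rightSide n n)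
    (ha₂ : a₂ ∈ leftSide n n) (hb₂ : b₂ ∈ rightSide n n)
    (h₁ : ω ∈ openConnIn (↑(rectangle n n)) a₁ b₁)
    (h₂ : ω ∈ openConnIn ((· + ![0, (k : ℤ)]) '' ↑(rectangle n n)) (a₂ + ![0, (k : ℤ)])
      (b₂ + ![0, (k : ℤ)]))
    (h₃ : ω ∈ openConnIn (↑(rectangle n (n + k))) a₁ (a₂ + ![0, (k : ℤ)]))
    (hV₁ : ω ∈ tbCrossing n n)
    (hV₂ : ω ∈ openCrossing ((· + ![0, (k : ℤ)]) '' ↑(rectangle n n))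
      ((· + ![0, (k : ℤ)]) '' ↑(bottomSide n n)) ((· + ![0, (k : ℤ)]) '' ↑(topSide n n))) :
    ω ∈ tbCrossing n (n + k) := by
  classical
  set v : Site 2 := ![0, (k : ℤ)] with hv
  have hv0 : v 0 = 0 := rfl
  have hv1 : v 1 = k := rfl
  set S₁ : Set (Site 2) := ↑(rectangle n n) with hS₁
  set S₂ : Set (Site 2) := (· + v) '' ↑(rectangle n n) with hS₂
  set Big : Set (Site 2) := ↑(rectangle n (n + k)) with hBig
  have hmemS₁ : ∀ z : Site 2, z ∈ S₁ ↔ 0 ≤ z 0 ∧ z 0 ≤ n ∧ 0 ≤ z 1 ∧ z 1 ≤ n := fun z => by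
    rw [hS₁, Finset.mem_coe, mem_rectangle_iff]
  have hmemS₂ : ∀ z : Site 2, z ∈ S₂ ↔ 0 ≤ z 0 ∧ z 0 ≤ n ∧ (k : ℤ) ≤ z 1 ∧ z 1 ≤ n + k :=
    fun z => by
    rw [hS₂, mem_image_add_rectangle, hv0, hv1]
    constructor <;> intro h <;> omega
  have hmemBig : ∀ z : Site 2, z ∈ Big ↔ 0 ≤ z 0 ∧ z 0 ≤ n ∧ 0 ≤ z 1 ∧ z 1 ≤ n + k := fun z => by
    rw [hBig, Finset.mem_coe, mem_rectangle_iff]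
    push_cast
    exact Iff.rfl
  have hS₁Big : S₁ ⊆ Big := fun z hz => by
    rw [hmemS₁] at hz
    rw [hmemBig]
    omega
  have hS₂Big : S₂ ⊆ Big := fun z hz => by
    rw [hmemS₂] at hz
    rw [hmemBig]
    omega
  simp only [leftSide, rightSide, Finset.mem_filter, mem_rectangle_iff] at ha₁ hb₁ ha₂ hb₂
  -- the horizontal and the vertical crossing of `S₁` meet at `w₁`
  obtain ⟨P₁, hP₁S, hP₁ω⟩ := exists_walk_of_mem_openConnIn hω h₁
  obtain ⟨p, hp, q, hq, hpq⟩ := hV₁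
  simp only [Finset.mem_coe, bottomSide, topSide, Finset.mem_filter, mem_rectangle_iff] at hp hq
  obtain ⟨Q₁, hQ₁S, hQ₁ω⟩ := exists_walk_of_mem_openConnIn hω hpq
  obtain ⟨w₁, hw₁P, hw₁Q⟩ := exists_mem_support_of_crossing (L := 0) (R := n) (B := 0) (T := n)
    P₁ Q₁ (fun z hz => (hmemS₁ z).1 (hP₁S z hz)) (fun z hz => (hmemS₁ z).1 (hQ₁S z hz)) ha₁.2
    hb₁.2 hp.2 hq.2
  -- the horizontal and the vertical crossing of `S₂` meet at `w₂`
  obtain ⟨P₂, hP₂S, hP₂ω⟩ := exists_walk_of_mem_openConnIn hω h₂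
  obtain ⟨p', hp', q', hq', hpq'⟩ := hV₂
  rw [mem_image_add_bottomSide, hv0, hv1] at hp'
  rw [mem_image_add_topSide, hv0, hv1] at hq'
  obtain ⟨Q₂, hQ₂S, hQ₂ω⟩ := exists_walk_of_mem_openConnIn hω hpq'
  obtain ⟨w₂, hw₂P, hw₂Q⟩ := exists_mem_support_of_crossing (L := 0) (R := n) (B := (k : ℤ))
    (T := n + k) P₂ Q₂ (fun z hz => (hmemS₂ z).1 (hP₂S z hz))
    (fun z hz => (hmemS₂ z).1 (hQ₂S z hz)) (by rw [Pi.add_apply, ha₂.2, hv0, add_zero])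
    (by rw [Pi.add_apply, hb₂.2, hv0, add_zero]) hp'.2 (by rw [hq'.2, add_comm])
  -- assemble `p ↔ w₁ ↔ a₁ ↔ a₂ + v ↔ w₂ ↔ q'` inside the big rectangle
  have c₁ : ω ∈ openConnIn Big p w₁ :=
    openConnIn_mono hS₁Big _ _ (mem_openConnIn_of_mem_support Q₁ hQ₁S hQ₁ω hw₁Q)
  have c₂ : ω ∈ openConnIn Big w₁ a₁ := by
    refine openConnIn_mono hS₁Big _ _ ?_
    rw [openConnIn_comm]
    exact mem_openConnIn_of_mem_support P₁ hP₁S hP₁ω hw₁P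
  have c₃ : ω ∈ openConnIn Big a₁ (a₂ + v) := h₃
  have c₄ : ω ∈ openConnIn Big (a₂ + v) w₂ :=
    openConnIn_mono hS₂Big _ _ (mem_openConnIn_of_mem_support P₂ hP₂S hP₂ω hw₂P)
  have c₅ : ω ∈ openConnIn Big w₂ q' := by
    refine openConnIn_mono hS₂Big _ _ (PlanarDuality.openConnIn_trans ?_ hpq')
    rw [openConnIn_comm]
    exact mem_openConnIn_of_mem_support Q₂ hQ₂S hQ₂ω hw₂Q
  refine ⟨p, ?_, q', ?_, PlanarDuality.openConnIn_trans (PlanarDuality.openConnIn_trans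
    (PlanarDuality.openConnIn_trans (PlanarDuality.openConnIn_trans c₁ c₂) c₃) c₄) c₅⟩
  · simp only [Finset.mem_coe, bottomSide, Finset.mem_filter, mem_rectangle_iff]
    push_cast
    omega
  · have hq'S := (hmemS₂ q').1 (hQ₂S q' Q₂.end_mem_support)
    simp only [Finset.mem_coe, topSide, Finset.mem_filter, mem_rectangle_iff]
    push_cast
    omega

/-- **JOIN ⇒ a vertical crossing of `[0, n] × [0, n + k]` with probability `≥ c/4`**
(Bollobás–Riordan 2010, Lemma 5.5 and the first display of the proof of Lemma 5.4, for `M_t`).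
If an increasing measurable event `J` with `M_t(J) ≥ c` forces, together with vertical crossings
of `S₁ = [0, n]²` and of `S₂ = S₁ + (0, k)`, a vertical crossing of `[0, n] × [0, n + k]` on
lattice configurations (an `M_t`-sure set, `cornerPercolation_subset_edgeSet`), then
`c/4 ≤ M_t(TB([0, n] × [0, n + k])) = M_t(LR([0, n + k] × [0, n]))`: Harris–FKG for `M_t`
(`cornerPercolation_real_inter_ge`) twice, squares being crossed with probability `≥ 1/2`
(`cornerPercolation_half_le_real_tbCrossing_self`, translation invariance
`cornerPercolation_real_openCrossing_shift`), and transposition (`cornerPercolation_real_tbCrossing`).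
[cite: BollobasRiordan2010, §5.1 Lemma 5.4] -/
theorem quarter_le_real_lrCrossing_of_join (t : unitInterval) {n k : ℕ} {c : ℝ}
    {J : Set (BondConfig (Site 2))} (hc : c ≤ (cornerPercolation t).real J) (hJu : IsUpperSet J)
    (hJm : MeasurableSet J)
    (hincl : ∀ ω : BondConfig (Site 2), ω ⊆ (zdGraph 2).edgeSet → ω ∈ J → ω ∈ tbCrossing n n →
      ω ∈ openCrossing ((· + ![0, (k : ℤ)]) '' ↑(rectangle n n))
        ((· + ![0, (k : ℤ)]) '' ↑(bottomSide n n)) ((· + ![0, (k : ℤ)]) '' ↑(topSide n n)) →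
      ω ∈ tbCrossing n (n + k)) :
    c / 4 ≤ (cornerPercolation t).real (lrCrossing (n + k) n) := by
  set V₁ := tbCrossing n n with hV₁def
  set V₂ := openCrossing ((· + ![0, (k : ℤ)]) '' (↑(rectangle n n) : Set (Site 2)))
    ((· + ![0, (k : ℤ)]) '' ↑(bottomSide n n)) ((· + ![0, (k : ℤ)]) '' ↑(topSide n n)) with hV₂def
  have hPV₂ : (cornerPercolation t).real V₂ = (cornerPercolation t).real (tbCrossing n n) := by
    rw [hV₂def, cornerPercolation_real_openCrossing_shift]
    rfl
  have hV₁ : 1 / 2 ≤ (cornerPercolation t).real V₁ := cornerPercolation_half_le_real_tbCrossing_self t n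
  have hV₂ : 1 / 2 ≤ (cornerPercolation t).real V₂ :=
    hPV₂ ▸ cornerPercolation_half_le_real_tbCrossing_self t n
  have hupV₁ : IsUpperSet V₁ := isUpperSet_tbCrossing n n
  have hupV₂ : IsUpperSet V₂ := isUpperSet_openCrossing _ _ _
  have hmsV₁ : MeasurableSet V₁ := measurableSet_tbCrossing n n
  have hmsV₂ : MeasurableSet V₂ := measurableSet_openCrossing_of_countable _ _ _
  have h12 : (cornerPercolation t).real J * (cornerPercolation t).real V₁ ≤
      (cornerPercolation t).real (J ∩ V₁) :=
    cornerPercolation_real_inter_ge t hJu hupV₁ hJm hmsV₁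
  have h123 : (cornerPercolation t).real (J ∩ V₁) * (cornerPercolation t).real V₂ ≤
      (cornerPercolation t).real (J ∩ V₁ ∩ V₂) :=
    cornerPercolation_real_inter_ge t (hJu.inter hupV₁) hupV₂ (hJm.inter hmsV₁) hmsV₂
  have hsub : (cornerPercolation t).real (J ∩ V₁ ∩ V₂) ≤
      (cornerPercolation t).real (tbCrossing n (n + k)) := by
    simp only [measureReal_def]
    refine ENNReal.toReal_mono (measure_ne_top _ _) (measure_mono_ae ?_)
    filter_upwards [cornerPercolation_subset_edgeSet t] with ω hω hmem
    exact hincl ω hω hmem.1.1 hmem.1.2 hmem.2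
  rw [cornerPercolation_real_tbCrossing] at hsub
  calc c / 4 = c * (1 / 2) * (1 / 2) := by ring
    _ ≤ (cornerPercolation t).real J * (cornerPercolation t).real V₁ *
          (cornerPercolation t).real V₂ :=
        mul_le_mul (mul_le_mul hc hV₁ (by norm_num) measureReal_nonneg) hV₂ (by norm_num)
          (mul_nonneg measureReal_nonneg measureReal_nonneg)
    _ ≤ (cornerPercolation t).real (J ∩ V₁) * (cornerPercolation t).real V₂ :=
        mul_le_mul_of_nonneg_right h12 measureReal_nonneg
    _ ≤ (cornerPercolation t).real (J ∩ V₁ ∩ V₂) := h123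
    _ ≤ (cornerPercolation t).real (lrCrossing (n + k) n) := hsub

/-- **Stub 3 (JOIN ⇒ hard-way crossings of `2:1` rectangles).** If horizontal crossings of two
`n`-squares shifted vertically by `k ≍ n/K` are joined inside their union with probability
`≥ c`, then `[0,n] × [0,n+k]` is crossed vertically with probability `≥ c/4` (crossings of a
square meet; Harris–FKG for `M_t`; squares are crossed with probability `≥ 1/2`), and
`≤ K + 1` vertical gluings through exact-`1/2` squares give a uniform lower bound for the
hard-way crossing of `[0,2n] × [0,n]` (Bollobás–Riordan 2010, Lemmas 5.4 and 5.5). Explicitly: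
`M_t(LR([0, n + j k] × [0, n])) ≥ (1/2) (c/8)^j` for every `j` (gluing inequality
`cornerPercolation_real_glue` with `m₁ = n + j k`, `m₂ = n + k` through the `n`-square), and
`2 n ≤ n + K k`, so `M_t(LR([0, 2n] × [0, n])) ≥ (1/2) (c/8)^K` by antitonicity in the width.
[cite: BollobasRiordan2010, §5.1 Lemma 5.4] -/
theorem stub_join
    (hJ : ∃ c : ℝ, 0 < c ∧ ∃ K n₀ : ℕ, ∀ (t : unitInterval) (n : ℕ), n₀ ≤ n →
      ∃ k : ℕ, 1 ≤ k ∧ k ≤ n ∧ n ≤ K * k ∧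
        c ≤ (cornerPercolation t).real {ω | ∃ a₁ ∈ leftSide n n, ∃ b₁ ∈ rightSide n n,
          ∃ a₂ ∈ leftSide n n, ∃ b₂ ∈ rightSide n n,
            ω ∈ openConnIn (↑(rectangle n n)) a₁ b₁ ∧
            ω ∈ openConnIn ((· + ![0, (k : ℤ)]) '' ↑(rectangle n n)) (a₂ + ![0, (k : ℤ)])
              (b₂ + ![0, (k : ℤ)]) ∧
            ω ∈ openConnIn (↑(rectangle n (n + k))) a₁ (a₂ + ![0, (k : ℤ)])}) :
    ∃ c : ℝ, 0 < c ∧ ∃ n₀ : ℕ, ∀ (t : unitInterval) (n : ℕ), n₀ ≤ n →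
      c ≤ (cornerPercolation t).real (lrCrossing (2 * n) n) := by
  obtain ⟨c, hc, K, n₀, h⟩ := hJ
  refine ⟨1 / 2 * (c / 8) ^ K, by positivity, n₀, fun t n hn => ?_⟩
  obtain ⟨k, -, -, hnK, hJc⟩ := h t n hn
  -- Lemma 5.5 + FKG: `c/4 ≤ M_t(LR(n + k, n))`
  have hB : c / 4 ≤ (cornerPercolation t).real (lrCrossing (n + k) n) := by
    refine quarter_le_real_lrCrossing_of_join t hJc ?_ ?_ ?_
    · rintro ω ω' hle ⟨a₁, ha₁, b₁, hb₁, a₂, ha₂, b₂, hb₂, e₁, e₂, e₃⟩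
      exact ⟨a₁, ha₁, b₁, hb₁, a₂, ha₂, b₂, hb₂, isUpperSet_openConnIn _ _ _ hle e₁,
        isUpperSet_openConnIn _ _ _ hle e₂, isUpperSet_openConnIn _ _ _ hle e₃⟩
    · refine measurableSet_setOf_exists_mem fun a₁ => measurableSet_setOf_exists_mem fun b₁ =>
        measurableSet_setOf_exists_mem fun a₂ => measurableSet_setOf_exists_mem fun b₂ => ?_
      exact (measurableSet_openConnIn_of_countable _ _ _).inter
        ((measurableSet_openConnIn_of_countable _ _ _).inter
          (measurableSet_openConnIn_of_countable _ _ _))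
    · rintro ω hω ⟨a₁, ha₁, b₁, hb₁, a₂, ha₂, b₂, hb₂, e₁, e₂, e₃⟩ hV₁ hV₂
      exact tbCrossing_of_join hω ha₁ hb₁ ha₂ hb₂ e₁ e₂ e₃ hV₁ hV₂
  -- Lemma 5.4: glue `j` rectangles `[0, n + k] × [0, n]` through `n`-squares
  have hC : ∀ j : ℕ, 1 / 2 * (c / 8) ^ j ≤
      (cornerPercolation t).real (lrCrossing (n + j * k) n) := by
    intro j
    induction j with
    | zero =>
      simp only [pow_zero, mul_one, zero_mul, add_zero]
      calc (1 : ℝ) / 2 = (cornerPercolation t).real (lrCrossing (n + 1) n) :=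
          (cornerPercolation_real_lrCrossing_succ_self t n).symm
        _ ≤ (cornerPercolation t).real (lrCrossing n n) :=
          cornerPercolation_real_lrCrossing_anti_left t (Nat.le_succ n) n
    | succ j ih =>
      have hg := cornerPercolation_real_glue t (m₁ := n + j * k) (m₂ := n + k) (n := n)
        (Nat.le_add_right n _) (Nat.le_add_right n k)
      have hw : n + j * k + (n + k) - n = n + (j + 1) * k := by
        rw [show n + j * k + (n + k) = n + (j + 1) * k + n by ring, Nat.add_sub_cancel]
      rw [hw] at hg
      refine le_trans ?_ hg
      have hV := cornerPercolation_half_le_real_tbCrossing_self t n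
      calc 1 / 2 * (c / 8) ^ (j + 1) = 1 / 2 * (c / 8) ^ j * (c / 4) * (1 / 2) := by ring
        _ ≤ (cornerPercolation t).real (lrCrossing (n + j * k) n) *
              (cornerPercolation t).real (lrCrossing (n + k) n) *
              (cornerPercolation t).real (tbCrossing n n) :=
          mul_le_mul (mul_le_mul ih hB (by positivity) measureReal_nonneg) hV (by norm_num)
            (mul_nonneg measureReal_nonneg measureReal_nonneg)
  calc 1 / 2 * (c / 8) ^ K ≤ (cornerPercolation t).real (lrCrossing (n + K * k) n) := hC K
    _ ≤ (cornerPercolation t).real (lrCrossing (2 * n) n) :=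
      cornerPercolation_real_lrCrossing_anti_left t (by omega) n

end Summit.CriticalPhenomena.CardyFormulaZ2.Cruxes.UniformBoxCrossing.NonSlantLine

end
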